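import Summits.CriticalPhenomena.PercolationContinuityZ3.Theorems.PercNearOneGluingNoHeavyQuantFarGate3ChartC
import Summits.CriticalPhenomena.PercolationContinuityZ3.Theorems.PercNearOneGluingNoHeavyQuantFarGate3PinchWLink
import Summits.CriticalPhenomena.PercolationContinuityZ3.Theorems.PercNearOneGluingNoHeavyQuantFarGate3PinchRLink
import Summits.CriticalPhenomena.PercolationContinuityZ3.Theorems.PercNearOneGluingNoHeavyQuantFarGate3PinchULink
import Summits.CriticalPhenomena.PercolationContinuityZ3.Theorems.PercNearOneGluingNoHeavyQuantFarGate3PinchPLink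
import Summits.CriticalPhenomena.PercolationContinuityZ3.Theorems.PercNearOneGluingNoHeavyQuantFarGate3PinchMLink
import HarnessLib

/-!
# QUANT lane R8, front "FAR beyond trees", layer one — THE DEGREE-THREE GATE AT THE OBSERVER, LXXII: the pinch ATLAS
# (`Gate3.chartC_of_pinchAtlas`: the five blow-up charts cover the hole `H` of the chart-C box machine around `(σ,u,r₁,r₂) = (1,0,0,1)`)

builds on p205010 (kernel theorem, internal audit signed; external expert review pending)

Support file (`--supports stmt-CriticalPhenomena-4575`), seat `prim-quant-p1` (gen 35); memo
`run/shared/lean/prim/quant/prim-quant-p1-g35/FOR-LEAD-GATE3-PINCH.md`.  The five link files LXXI-W/R/U/P/M only; standard axioms; no sorries.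
GENERATED by `work/chartP/gen_atlas.py` (the chart-C statement text is that of file XLVI).

Let `w = 1 − r₂`, `m = max(w, r₁, u)` (`> 0` since `u > 0`).  If `|σ − 1| ≤ 3m`, blow up along the largest of `w, r₁, u` (charts W, R, U: `y = m ≤ 3/16` resp. `1/8`,
the two ratios in `[0,1]`, `c = (σ−1)/y ∈ [−3,3]`); otherwise along `|σ − 1|` (charts P for `σ > 1`, M for `σ < 1`: `y = |σ−1| ≤ 1/8`, ratios `< 1/3`).
So `CertN.BoxOKR` for the five chart specs on the boxes `[0,3/16]×[0,1]²×[−3,3]` (W), `[0,1/8]×[0,1]²×[−3,3]` (R, U) and `[0,1/8]×[0,1/3]³` (P, M) — the content of the data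
files — refutes the chart-C system on the whole hole `H = {7/8 ≤ σ ≤ 9/8, 0 < u ≤ 1/8, 0 ≤ r₁ ≤ 1/8, r₁ ≤ r₂, 13/16 ≤ r₂ < 1, σu ≤ 1}`
(chosen to contain every box on which the chart-C certificates of the strip `r₁ ≤ 1/10`, `r₂ ≥ 4/5` fail, kit j252986/j252989).
[this work].
-/

namespace Summit.CriticalPhenomena.PercolationContinuityZ3.Theorems

namespace Quant

namespace Gate3

set_option maxHeartbeats 4000000 in
/-- **The pinch atlas.** [this work] -/
theorem chartC_of_pinchAtlas (σ u r₁ r₂ : ℝ) (hσlo : (7 : ℝ) / 8 ≤ σ) (hσhi : σ ≤ (9 : ℝ) / 8) (hu0 : 0 < u) (huhi : u ≤ (1 : ℝ) / 8)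
    (hr10 : 0 ≤ r₁) (hr1hi : r₁ ≤ (1 : ℝ) / 8) (hr12 : r₁ ≤ r₂) (hr2lo : (13 : ℝ) / 16 ≤ r₂) (hr2 : r₂ < 1) (hσu : σ * u ≤ 1)
    (HW : CertN.BoxOKR PinchW.spec (0 : ℝ) ((3 : ℝ) / 16) (0 : ℝ) (1 : ℝ) (0 : ℝ) (1 : ℝ) (-3 : ℝ) (3 : ℝ))
    (HR : CertN.BoxOKR PinchR.spec (0 : ℝ) ((1 : ℝ) / 8) (0 : ℝ) (1 : ℝ) (0 : ℝ) (1 : ℝ) (-3 : ℝ) (3 : ℝ))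
    (HU : CertN.BoxOKR PinchU.spec (0 : ℝ) ((1 : ℝ) / 8) (0 : ℝ) (1 : ℝ) (0 : ℝ) (1 : ℝ) (-3 : ℝ) (3 : ℝ))
    (HP : CertN.BoxOKR PinchP.spec (0 : ℝ) ((1 : ℝ) / 8) (0 : ℝ) ((1 : ℝ) / 3) (0 : ℝ) ((1 : ℝ) / 3) (0 : ℝ) ((1 : ℝ) / 3))
    (HM : CertN.BoxOKR PinchM.spec (0 : ℝ) ((1 : ℝ) / 8) (0 : ℝ) ((1 : ℝ) / 3) (0 : ℝ) ((1 : ℝ) / 3) (0 : ℝ) ((1 : ℝ) / 3)) :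
    ∀ (a0 a1 A2 B1 B2 c0 c1 D : ℝ), 0 ≤ a0 → 0 ≤ a1 → 0 ≤ A2 → 0 ≤ B1 → 0 ≤ B2 → 0 ≤ c0 → 0 ≤ c1 → 0 ≤ D →
    B1 * (u * B2 + (c0 + c1)) ≤ σ * D * (a0 + a1 + σ * u * A2) →
    B2 * (u * B1 + (c0 + c1)) ≤ σ * D * (a0 + a1 + σ * u * A2) →
    (c0 + c1) * (B1 + B2) ≤ σ * D * (a0 + a1 + σ * u * A2) →
    B1 * (a1 + σ * u * A2 + c1 + σ * u * D) ≤ σ * D * (a0 + u * B1 + u * B2 + c0) →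
    B2 * (a1 + σ * u * A2 + c1 + σ * u * D) ≤ σ * D * (a0 + u * B1 + u * B2 + c0) →
    c0 * (a1 + σ * u * A2 + c1 + σ * u * D) ≤ (c1 + σ * u * D) * (a0 + u * B1 + u * B2 + c0) →
    0 < ((1 - r₁) * (1 - r₂)) * (a0 + c0) - (1 - σ * u) * A2 - (1 - σ * u) * ((1 - r₁) * (1 - r₂)) * D →
    0 < (1 - σ * u) * (1 - r₁) * B1 - σ * (r₂ * (1 - r₁)) * a0 - σ * (1 - r₁) * a1 - σ * (1 - σ * u * r₁) * A2 - (1 - (1 - σ * u) * (1 - r₂)) * (1 - r₁) * B2 - σ * ((1 - r₁) * (1 - r₂)) * c1 →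
    0 < (1 - σ * u) * (1 - r₂) * B2 - σ * (r₁ * (1 - r₂)) * a0 - σ * (1 - r₂) * a1 - σ * (1 - σ * u * r₂) * A2 - (1 - (1 - σ * u) * (1 - r₁)) * (1 - r₂) * B1 - σ * ((1 - r₁) * (1 - r₂)) * c1 →
    0 < (1 - σ * u * max r₁ r₂ - σ * (1 - max r₁ r₂)) * a1 + (1 - σ * u * (r₁ + r₂ * (1 - r₁)) - σ * ((1 - r₁) * (1 - r₂))) * c1 - σ * (r₁ + r₂ * (1 - r₁) - max r₁ r₂) * a0 - ((1 - (1 - σ * u) * (1 - r₁)) * (1 - r₂)) * B1 - ((1 - (1 - σ * u) * (1 - r₂)) * (1 - r₁)) * B2 →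
    0 < (σ * u * (1 + r₁ + r₂) + σ * max r₁ r₂ - 2) * a0 + (σ * u * (1 + r₁ + r₂) + σ * max r₁ r₂ - σ * u * max r₁ r₂ - 1) * a1 + σ * (σ * u * u * (1 + r₁ + r₂) + 1 - 2 * u) * A2 + ((1 - (1 - σ * u) * (1 - r₁)) * (u + r₂ * (1 + u)) - u) * B1 + ((1 - (1 - σ * u) * (1 - r₂)) * (u + r₁ * (1 + u)) - u) * B2 + (σ * u + (σ + 2 * (σ * u)) * (r₁ + r₂ * (1 - r₁)) - 2) * c0 + (σ * u + (σ + σ * u) * (r₁ + r₂ * (1 - r₁)) - 1) * c1 + (σ + σ * u - σ * u * ((1 - σ * u) * ((1 - r₁) * (1 - r₂)))) * D →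
    False := by
  have hσ0 : 0 ≤ σ := by linarith
  have hr21 : r₂ ≤ 1 := hr2.le
  have hul : u ≤ 1 := by linarith
  have hw0 : 0 < 1 - r₂ := by linarith
  have hw8 : 1 - r₂ ≤ (3 : ℝ) / 16 := by linarith
  by_cases hbig : 3 * max (1 - r₂) (max r₁ u) < |σ - 1|
  · -- blow up along |σ - 1|: charts P / M
    have hm0 : 0 < max (1 - r₂) (max r₁ u) := lt_max_of_lt_left hw0
    have hwm : 1 - r₂ ≤ max (1 - r₂) (max r₁ u) := le_max_left _ _
    have hrm : r₁ ≤ max (1 - r₂) (max r₁ u) := le_trans (le_max_left _ _) (le_max_right _ _)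
    have hum : u ≤ max (1 - r₂) (max r₁ u) := le_trans (le_max_right _ _) (le_max_right _ _)
    rcases le_or_gt 1 σ with hge | hlt
    · -- chart P, y = σ - 1
      have hy : |σ - 1| = σ - 1 := abs_of_nonneg (by linarith)
      rw [hy] at hbig
      have hy0 : 0 < σ - 1 := by linarith
      have hy8 : σ - 1 ≤ (1 : ℝ) / 8 := by linarith
      have ha : (1 - r₂) / (σ - 1) ≤ (1 : ℝ) / 3 := by rw [div_le_iff₀ hy0]; linarith
      have hb : r₁ / (σ - 1) ≤ (1 : ℝ) / 3 := by rw [div_le_iff₀ hy0]; linarith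
      have hc : u / (σ - 1) ≤ (1 : ℝ) / 3 := by rw [div_le_iff₀ hy0]; linarith
      exact PinchP.chartC_of_noBad (σ - 1) ((1 - r₂) / (σ - 1)) (r₁ / (σ - 1)) (u / (σ - 1)) hy0
        (HP (σ - 1) ((1 - r₂) / (σ - 1)) (r₁ / (σ - 1)) (u / (σ - 1)) hy0.le hy8 (div_nonneg hw0.le hy0.le) ha (div_nonneg hr10 hy0.le) hb
          (div_nonneg hu0.le hy0.le) hc)
        σ u r₁ r₂ (by ring) (by field_simp) (by field_simp) (by field_simp; ring) hσ0 hu0.le hσu hr10 hr12 hr21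
    · -- chart M, y = 1 - σ
      have hy : |σ - 1| = 1 - σ := by rw [abs_sub_comm]; exact abs_of_nonneg (by linarith)
      rw [hy] at hbig
      have hy0 : 0 < 1 - σ := by linarith
      have hy8 : 1 - σ ≤ (1 : ℝ) / 8 := by linarith
      have ha : (1 - r₂) / (1 - σ) ≤ (1 : ℝ) / 3 := by rw [div_le_iff₀ hy0]; linarith
      have hb : r₁ / (1 - σ) ≤ (1 : ℝ) / 3 := by rw [div_le_iff₀ hy0]; linarith
      have hc : u / (1 - σ) ≤ (1 : ℝ) / 3 := by rw [div_le_iff₀ hy0]; linarith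
      exact PinchM.chartC_of_noBad (1 - σ) ((1 - r₂) / (1 - σ)) (r₁ / (1 - σ)) (u / (1 - σ)) hy0
        (HM (1 - σ) ((1 - r₂) / (1 - σ)) (r₁ / (1 - σ)) (u / (1 - σ)) hy0.le hy8 (div_nonneg hw0.le hy0.le) ha (div_nonneg hr10 hy0.le) hb
          (div_nonneg hu0.le hy0.le) hc)
        σ u r₁ r₂ (by ring) (by field_simp) (by field_simp) (by field_simp; ring) hσ0 hu0.le hσu hr10 hr12 hr21
  · push Not at hbig
    -- blow up along the largest of w, r₁, u: charts W / R / U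
    rcases le_total (max r₁ u) (1 - r₂) with h1 | h1
    · -- chart W, y = 1 - r₂
      have hmax : max (1 - r₂) (max r₁ u) = 1 - r₂ := max_eq_left h1
      rw [hmax] at hbig
      obtain ⟨hc1, hc2⟩ := abs_le.mp hbig
      have hr1w : r₁ ≤ 1 - r₂ := le_trans (le_max_left _ _) h1
      have huw : u ≤ 1 - r₂ := le_trans (le_max_right _ _) h1
      have hclo : (-3 : ℝ) ≤ (σ - 1) / (1 - r₂) := by rw [le_div_iff₀ hw0]; linarith
      have hchi : (σ - 1) / (1 - r₂) ≤ (3 : ℝ) := by rw [div_le_iff₀ hw0]; linarith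
      exact PinchW.chartC_of_noBad (1 - r₂) (r₁ / (1 - r₂)) (u / (1 - r₂)) ((σ - 1) / (1 - r₂)) hw0
        (HW (1 - r₂) (r₁ / (1 - r₂)) (u / (1 - r₂)) ((σ - 1) / (1 - r₂)) hw0.le hw8 (div_nonneg hr10 hw0.le) ((div_le_one hw0).2 hr1w)
          (div_nonneg hu0.le hw0.le) ((div_le_one hw0).2 huw) hclo hchi)
        σ u r₁ r₂ (by field_simp; ring) (by field_simp) (by field_simp) (by ring) hσ0 hu0.le hσu hr10 hr12 hr21
    · rcases le_total u r₁ with h2 | h2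
      · -- chart R, y = r₁
        have hmax : max (1 - r₂) (max r₁ u) = r₁ := by rw [max_eq_left h2] at h1 ⊢; exact max_eq_right h1
        rw [hmax] at hbig
        obtain ⟨hc1, hc2⟩ := abs_le.mp hbig
        have hy0 : 0 < r₁ := lt_of_lt_of_le hu0 h2
        have hwr : 1 - r₂ ≤ r₁ := by rw [max_eq_left h2] at h1; exact h1
        have hclo : (-3 : ℝ) ≤ (σ - 1) / r₁ := by rw [le_div_iff₀ hy0]; linarith
        have hchi : (σ - 1) / r₁ ≤ (3 : ℝ) := by rw [div_le_iff₀ hy0]; linarith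
        exact PinchR.chartC_of_noBad r₁ ((1 - r₂) / r₁) (u / r₁) ((σ - 1) / r₁) hy0
          (HR r₁ ((1 - r₂) / r₁) (u / r₁) ((σ - 1) / r₁) hy0.le hr1hi (div_nonneg hw0.le hy0.le) ((div_le_one hy0).2 hwr)
            (div_nonneg hu0.le hy0.le) ((div_le_one hy0).2 h2) hclo hchi)
          σ u r₁ r₂ (by field_simp; ring) (by field_simp) rfl (by field_simp; ring) hσ0 hu0.le hσu hr10 hr12 hr21
      · -- chart U, y = u
        have hmax : max (1 - r₂) (max r₁ u) = u := by rw [max_eq_right h2] at h1 ⊢; exact max_eq_right h1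
        rw [hmax] at hbig
        obtain ⟨hc1, hc2⟩ := abs_le.mp hbig
        have hwu : 1 - r₂ ≤ u := by rw [max_eq_right h2] at h1; exact h1
        have hclo : (-3 : ℝ) ≤ (σ - 1) / u := by rw [le_div_iff₀ hu0]; linarith
        have hchi : (σ - 1) / u ≤ (3 : ℝ) := by rw [div_le_iff₀ hu0]; linarith
        exact PinchU.chartC_of_noBad u ((1 - r₂) / u) (r₁ / u) ((σ - 1) / u) hu0
          (HU u ((1 - r₂) / u) (r₁ / u) ((σ - 1) / u) hu0.le huhi (div_nonneg hw0.le hu0.le) ((div_le_one hu0).2 hwu)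
            (div_nonneg hr10 hu0.le) ((div_le_one hu0).2 h2) hclo hchi)
          σ u r₁ r₂ (by field_simp; ring) rfl (by field_simp) (by field_simp; ring) hσ0 hu0.le hσu hr10 hr12 hr21

/-- **`hred8` on the pinch hole**: for `0 < p`, `nn ≥ 8`, `7/8 ≤ nn·p ≤ 9/8`, `0 ≤ r₁ ≤ 1/8`, `r₁ ≤ r₂`, `13/16 ≤ r₂ < 1`, `p ≤ 1`, given the five
charts' certificate data, the 8-cell statement holds (`Gate3.red8_of_chartC ∘ Gate3.chartC_of_pinchAtlas`). [this work] -/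
theorem red8_pinch_of_data (p r₁ r₂ nn : ℝ) (hp0 : 0 < p) (hp1 : p ≤ 1) (hn : 8 ≤ nn) (hslo : (7 : ℝ) / 8 ≤ nn * p) (hshi : nn * p ≤ (9 : ℝ) / 8)
    (hr10 : 0 ≤ r₁) (hr1hi : r₁ ≤ (1 : ℝ) / 8) (hr12 : r₁ ≤ r₂) (hr2lo : (13 : ℝ) / 16 ≤ r₂) (hr2 : r₂ < 1)
    (HW : CertN.BoxOKR PinchW.spec (0 : ℝ) ((3 : ℝ) / 16) (0 : ℝ) (1 : ℝ) (0 : ℝ) (1 : ℝ) (-3 : ℝ) (3 : ℝ))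
    (HR : CertN.BoxOKR PinchR.spec (0 : ℝ) ((1 : ℝ) / 8) (0 : ℝ) (1 : ℝ) (0 : ℝ) (1 : ℝ) (-3 : ℝ) (3 : ℝ))
    (HU : CertN.BoxOKR PinchU.spec (0 : ℝ) ((1 : ℝ) / 8) (0 : ℝ) (1 : ℝ) (0 : ℝ) (1 : ℝ) (-3 : ℝ) (3 : ℝ))
    (HP : CertN.BoxOKR PinchP.spec (0 : ℝ) ((1 : ℝ) / 8) (0 : ℝ) ((1 : ℝ) / 3) (0 : ℝ) ((1 : ℝ) / 3) (0 : ℝ) ((1 : ℝ) / 3))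
    (HM : CertN.BoxOKR PinchM.spec (0 : ℝ) ((1 : ℝ) / 8) (0 : ℝ) ((1 : ℝ) / 3) (0 : ℝ) ((1 : ℝ) / 3) (0 : ℝ) ((1 : ℝ) / 3)) :
    ∀ (a0 a1 a2 b1 b2 c0 c1 d : ℝ), 0 ≤ a0 → 0 ≤ a1 → 0 ≤ a2 → 0 ≤ b1 → 0 ≤ b2 → 0 ≤ c0 → 0 ≤ c1 → 0 ≤ d →
    b1 * (b2 + (c0 + c1)) ≤ (a0 + a1 + a2) * d →
    b2 * (b1 + (c0 + c1)) ≤ (a0 + a1 + a2) * d →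
    (c0 + c1) * (b1 + b2) ≤ (a0 + a1 + a2) * d →
    b1 * (a1 + a2 + c1 + d) ≤ d * (a0 + b1 + b2 + c0) →
    b2 * (a1 + a2 + c1 + d) ≤ d * (a0 + b1 + b2 + c0) →
    c0 * (a1 + a2 + c1 + d) ≤ (c1 + d) * (a0 + b1 + b2 + c0) →
    0 < p * ((1 - r₁) * (1 - r₂)) * (a0 + c0) - (1 - p) * a2 - (1 - p) * ((1 - r₁) * (1 - r₂)) * d →
    0 < (1 - p) * (1 - r₁) * b1 - p * (r₂ * (1 - r₁)) * a0 - p * (1 - r₁) * a1 - (1 - p * r₁) * a2 - (1 - (1 - p) * (1 - r₂)) * (1 - r₁) * b2 - p * ((1 - r₁) * (1 - r₂)) * c1 →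
    0 < (1 - p) * (1 - r₂) * b2 - p * (r₁ * (1 - r₂)) * a0 - p * (1 - r₂) * a1 - (1 - p * r₂) * a2 - (1 - (1 - p) * (1 - r₁)) * (1 - r₂) * b1 - p * ((1 - r₁) * (1 - r₂)) * c1 →
    0 < (1 - p * max r₁ r₂ - nn * p * (1 - max r₁ r₂)) * a1 + (1 - p * (r₁ + r₂ * (1 - r₁)) - nn * p * ((1 - r₁) * (1 - r₂))) * c1 - nn * p * (r₁ + r₂ * (1 - r₁) - max r₁ r₂) * a0 - nn * ((1 - (1 - p) * (1 - r₁)) * (1 - r₂)) * b1 - nn * ((1 - (1 - p) * (1 - r₂)) * (1 - r₁)) * b2 →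
    0 < (p * (1 + r₁ + r₂ + nn * max r₁ r₂) - 2) * a0 + (p * (1 + r₁ + r₂) + p * max r₁ r₂ * (nn - 1) - 1) * a1 + (p * (1 + r₁ + r₂) + nn - 2) * a2 + ((1 - (1 - p) * (1 - r₁)) * (1 + r₂ * (nn + 1)) - 1) * b1 + ((1 - (1 - p) * (1 - r₂)) * (1 + r₁ * (nn + 1)) - 1) * b2 + (p * (1 + (nn + 2) * (r₁ + r₂ * (1 - r₁))) - 2) * c0 + (p * (1 + (nn + 1) * (r₁ + r₂ * (1 - r₁))) - 1) * c1 + (nn + 1 - (1 - p) * ((1 - r₁) * (1 - r₂))) * d →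
    False
     := by
  have hn0 : 0 < nn := by linarith
  have hu0 : 0 < 1 / nn := by positivity
  have huhi : 1 / nn ≤ (1 : ℝ) / 8 := by rw [div_le_div_iff_of_pos_left one_pos hn0 (by norm_num)]; exact hn
  have hσu : nn * p * (1 / nn) ≤ 1 := by
    have e : nn * p * (1 / nn) = p := by field_simp
    rw [e]; exact hp1
  exact red8_of_chartC p r₁ r₂ nn (nn * p) (1 / nn) hp0 hn0 rfl rfl
    (chartC_of_pinchAtlas (nn * p) (1 / nn) r₁ r₂ hslo hshi hu0 huhi hr10 hr1hi hr12 hr2lo hr2 hσu HW HR HU HP HM)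

end Gate3

end Quant

end Summit.CriticalPhenomena.PercolationContinuityZ3.Theorems
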